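import Literature.MathematicalPhysics.KineticTheory.HardSphereEulerLLN
import HarnessLib

/-!
# A Ruelle-type upper bound for the pair law of the canonical hard-sphere gas on `𝕋³`

Topic `Literature/MathematicalPhysics/KineticTheory` (companion of `HardSphereCanonicalTorus` / `HardSphereEulerRatio` /
`HardSphereEulerLLN`; used by the rung-0 (global equilibrium) statics of the crux line `even-rung-mean-variance` of
`JParityClosure.EvenStressEnskog`, stmt-AtomisticToContinuum-13079: collision-tube means, collision-flux bounds, three-body
tube remainders, tube variances).

For `N + 1` hard spheres of diameter `ε_N = hsDiameter σ N` on the unit torus, uniform activity, at small reduced density `σ`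
(`SmallDensity uniformProfile σ`), and two labels `i ≠ j`, the probability under the configurational canonical measure
`posGibbsMeasure 1 ε_N (N+1)` that `x_i − x_j` falls into a measurable set `T ⊆ 𝕋³` is at most `4 · vol(T)` — uniformly in
`N ≥ 1` and in `T`, in particular at CONTACT SCALE `vol(T) = O(ε_N³)` where the pair correlation is not close to `1`:

* `pi_hardCore_inter_pairEvent_le` — dropping the hard-core constraints that involve `i` or `j` and integrating `x_i` out by
  translation invariance of Haar measure: `ℙ^{⊗}(hard core ∩ {x_i − x_j ∈ T}) ≤ Ξ(univ ∖ {i,j}) · vol(T)`;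
* `posGibbs_pairEvent_le_ratio` — hence `posGibbsMeasure 1 ε (N+1) {x_i − x_j ∈ T} ≤ (Ξ_N(N−1)/Ξ_N(N+1)) · vol(T)`;
* `posGibbs_pairEvent_le` — and `Ξ_N(N−1)/Ξ_N(N+1) = q_N(N−1) q_N(N) ≤ 4` at small density (`SmallDensity.qN_le_two`).

This is the two-point case of the Ruelle bound `ρ_m ≤ (n/ Ξ-ratio)^m` obtained from the monotonicity of the hard-core
probability and the insertion ratios (Ruelle 1969 §4.2; Pulvirenti–Tsagkarogiannis 2012 §3).

## References
* D. Ruelle, *Statistical Mechanics: Rigorous Results* (1969), §4.2.  [Ruelle1969]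
* E. Pulvirenti, D. Tsagkarogiannis, Comm. Math. Phys. 316 (2012) 289–306, §3.  [PulvirentiTsagkarogiannis2012]
-/

noncomputable section

namespace Literature.MathematicalPhysics.KineticTheory

open MeasureTheory ProbabilityTheory Finset Filter Set StatisticalMechanics
open scoped ENNReal

/-- The pair event `{x | x i − x j ∈ T}` is measurable. [folklore] -/
theorem measurableSet_pairEvent {n : ℕ} (i j : Fin n) {T : Set T3} (hT : MeasurableSet T) :
    MeasurableSet {x : Fin n → T3 | x i - x j ∈ T} :=
  ((measurable_pi_apply i).sub (measurable_pi_apply j)) hT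

/-- Integrating out `x_i` by translation invariance: `∫ 𝟙_T(y − x_j) dy = vol(T)` whatever `x_j`, hence
`ℙ^{⊗}{x_i − x_j ∈ T} = vol(T)` for `i ≠ j` under the product of Haar probability measures. [folklore] -/
theorem pi_pairEvent_eq {n : ℕ} {i j : Fin n} (hij : i ≠ j) {T : Set T3} (hT : MeasurableSet T) :
    (Measure.pi fun _ : Fin n => (volume : Measure T3)) {x | x i - x j ∈ T} = volume T := by
  classical
  have hE := measurableSet_pairEvent (n := n) i j hT
  rw [← lintegral_indicator_one hE,
    lintegral_pi_eq_lintegral_update (volume : Measure T3) i ((measurable_one.indicator hE))]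
  have hinner : ∀ x : Fin n → T3,
      ∫⁻ y, ({x : Fin n → T3 | x i - x j ∈ T}).indicator 1 (Function.update x i y) ∂(volume : Measure T3)
        = volume T := by
    intro x
    have hset : (fun y : T3 => ({x : Fin n → T3 | x i - x j ∈ T}).indicator (1 : (Fin n → T3) → ℝ≥0∞)
        (Function.update x i y)) = ((fun y : T3 => y - x j) ⁻¹' T).indicator 1 := by
      funext y
      simp only [Set.indicator, Set.mem_setOf_eq, Set.mem_preimage, Function.update_self,
        Function.update_of_ne hij.symm, Pi.one_apply]
    rw [hset, lintegral_indicator_one (measurable_sub_const _ hT)]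
    have hfun : (fun y : T3 => y - x j) = fun y => y + -x j := by
      funext y; rw [sub_eq_add_neg]
    rw [hfun]
    exact measure_preimage_add_right _ _ _
  simp_rw [hinner]
  rw [lintegral_const, measure_univ, mul_one]

/-- **Dropping constraints and integrating out the pair**: for `i ≠ j` and measurable `T`,
`ℙ^{⊗}(hardCore(univ) ∩ {x_i − x_j ∈ T}) ≤ Ξ(univ ∖ {i, j}) · vol(T)`. [folklore] -/
theorem pi_hardCore_inter_pairEvent_le (ε : ℝ) {n : ℕ} {i j : Fin n} (hij : i ≠ j) {T : Set T3}
    (hT : MeasurableSet T) :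
    (Measure.pi fun _ : Fin n => (volume : Measure T3))
        (hardCoreSet (Ov ε) (univ : Finset (Fin n)) ∩ {x | x i - x j ∈ T})
      ≤ ENNReal.ofReal (hcProb (Ov ε) (volume : Measure T3) ((univ : Finset (Fin n)) \ {i, j})) * volume T := by
  classical
  set W : Finset (Fin n) := (univ : Finset (Fin n)) \ {i, j} with hW
  set P : Measure (Fin n → T3) := Measure.pi fun _ : Fin n => (volume : Measure T3) with hP
  have hHC : MeasurableSet (hardCoreSet (Ov ε) W : Set (Fin n → T3)) :=
    measurableSet_hardCoreSet (measurableSet_ov ε) W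
  have hE := measurableSet_pairEvent (n := n) i j hT
  -- monotonicity of the hard core in the label set
  have hsub : hardCoreSet (Ov ε) (univ : Finset (Fin n)) ∩ {x : Fin n → T3 | x i - x j ∈ T}
      ⊆ hardCoreSet (Ov ε) W ∩ {x | x i - x j ∈ T} :=
    Set.inter_subset_inter_left _ fun x hx a ha b hb hab => hx a (mem_univ a) b (mem_univ b) hab
  refine (measure_mono hsub).trans ?_
  -- factorisation: the two indicators depend on disjoint label sets
  have hdisj : Disjoint W ({i, j} : Finset (Fin n)) := sdiff_disjoint
  have hF : DependsOn (fun x : Fin n → T3 => (hardCoreSet (Ov ε) W : Set (Fin n → T3)).indicator (1 : (Fin n → T3) → ℝ) x)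
      (W : Set (Fin n)) := by
    intro x y hxy
    change (hardCoreSet (Ov ε) W : Set (Fin n → T3)).indicator (1 : (Fin n → T3) → ℝ) x
      = (hardCoreSet (Ov ε) W : Set (Fin n → T3)).indicator (1 : (Fin n → T3) → ℝ) y
    have hiff : x ∈ hardCoreSet (Ov ε) W ↔ y ∈ hardCoreSet (Ov ε) W := by
      simp only [hardCoreSet, Set.mem_setOf_eq]
      constructor
      · intro h a ha b hb hab; rw [← hxy a ha, ← hxy b hb]; exact h a ha b hb hab
      · intro h a ha b hb hab; rw [hxy a ha, hxy b hb]; exact h a ha b hb hab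
    by_cases hx : x ∈ hardCoreSet (Ov ε) W
    · rw [Set.indicator_of_mem hx, Set.indicator_of_mem (hiff.1 hx)]; rfl
    · rw [Set.indicator_of_notMem hx, Set.indicator_of_notMem (fun hy => hx (hiff.2 hy))]
  have hG : DependsOn (fun x : Fin n → T3 => ({x : Fin n → T3 | x i - x j ∈ T}).indicator (1 : (Fin n → T3) → ℝ) x)
      ((({i, j} : Finset (Fin n)) : Set (Fin n))) := by
    intro x y hxy
    change ({x : Fin n → T3 | x i - x j ∈ T}).indicator (1 : (Fin n → T3) → ℝ) x
      = ({x : Fin n → T3 | x i - x j ∈ T}).indicator (1 : (Fin n → T3) → ℝ) y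
    have hi : x i = y i := hxy i (by simp)
    have hj : x j = y j := hxy j (by simp)
    have hiff : x ∈ {x : Fin n → T3 | x i - x j ∈ T} ↔ y ∈ {x : Fin n → T3 | x i - x j ∈ T} := by
      simp only [Set.mem_setOf_eq, hi, hj]
    by_cases hx : x ∈ {x : Fin n → T3 | x i - x j ∈ T}
    · rw [Set.indicator_of_mem hx, Set.indicator_of_mem (hiff.1 hx)]; rfl
    · rw [Set.indicator_of_notMem hx, Set.indicator_of_notMem (fun hy => hx (hiff.2 hy))]
  have hFm : Measurable fun x : Fin n → T3 =>
      (hardCoreSet (Ov ε) W : Set (Fin n → T3)).indicator (1 : (Fin n → T3) → ℝ) x :=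
    measurable_one.indicator hHC
  have hGm : Measurable fun x : Fin n → T3 =>
      ({x : Fin n → T3 | x i - x j ∈ T}).indicator (1 : (Fin n → T3) → ℝ) x :=
    measurable_one.indicator hE
  have hprod := integral_mul_eq_of_dependsOn (volume : Measure T3) hdisj hFm hGm hF hG
  -- translate measures into integrals of indicators
  have hinter : (hardCoreSet (Ov ε) W ∩ {x : Fin n → T3 | x i - x j ∈ T}).indicator (1 : (Fin n → T3) → ℝ)
      = fun x => (hardCoreSet (Ov ε) W : Set (Fin n → T3)).indicator 1 x *
          ({x : Fin n → T3 | x i - x j ∈ T}).indicator 1 x := by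
    rw [Set.inter_indicator_one]
    rfl
  have h1 : P.real (hardCoreSet (Ov ε) W ∩ {x | x i - x j ∈ T})
      = hcProb (Ov ε) (volume : Measure T3) W * (volume : Measure T3).real T := by
    rw [← integral_indicator_one (hHC.inter hE), hinter, hP, hprod, integral_indicator_one hHC,
      integral_indicator_one hE, hcProb]
    congr 1
    rw [measureReal_def, measureReal_def, pi_pairEvent_eq hij hT]
  haveI : IsFiniteMeasure P := by rw [hP]; infer_instance
  have hfin : P (hardCoreSet (Ov ε) W ∩ {x | x i - x j ∈ T}) ≠ ∞ := measure_ne_top _ _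
  rw [← ENNReal.ofReal_toReal hfin, ← measureReal_def, h1,
    ENNReal.ofReal_mul (hcProb_nonneg (volume : Measure T3) W), measureReal_def,
    ENNReal.ofReal_toReal (measure_ne_top _ _)]

/-! ## The canonical measure: the pair law is at most `Ξ(n−2)/Ξ(n)` times Haar measure -/

/-- The one-particle law of the uniform profile is Haar measure. [folklore] -/
theorem uniformProfile_μ : uniformProfile.μ = (volume : Measure T3) := by
  change volume.withDensity (fun y => ENNReal.ofReal ((fun _ : T3 => (1 : ℝ)) y)) = volume
  simp only [ENNReal.ofReal_one]
  exact withDensity_one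

/-- The profile of the constant activity `1` has Haar measure as its one-particle law. [folklore] -/
theorem profileOf_one_μ :
    (profileOf (fun _ : T3 => (1 : ℝ)) continuous_const (fun _ => one_pos)).μ = (volume : Measure T3) := by
  change volume.withDensity (fun y => ENNReal.ofReal
    ((profileOf (fun _ : T3 => (1 : ℝ)) continuous_const (fun _ => one_pos)).β y)) = volume
  have hβ : ∀ y : T3, (profileOf (fun _ : T3 => (1 : ℝ)) continuous_const (fun _ => one_pos)).β y = 1 := by
    intro y
    rw [profileOf_β]
    simp
  simp only [hβ, ENNReal.ofReal_one]
  exact withDensity_one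

/-- **The canonical pair law is dominated by `Ξ(univ ∖ {i,j}) / Ξ(univ)` times Haar measure.** For `n` uniform hard spheres
of diameter `ε` on `𝕋³`, `i ≠ j` and measurable `T ⊆ 𝕋³`:
`posGibbsMeasure 1 ε n {x_i − x_j ∈ T} ≤ (Ξ(univ ∖ {i,j}) · Ξ(univ)⁻¹) · vol(T)`. [folklore] -/
theorem posGibbs_pairEvent_le_ratio (ε : ℝ) {n : ℕ} {i j : Fin n} (hij : i ≠ j) {T : Set T3}
    (hT : MeasurableSet T) :
    posGibbsMeasure (fun _ => (1 : ℝ)) ε n {x | x i - x j ∈ T}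
      ≤ ENNReal.ofReal (hcProb (Ov ε) (volume : Measure T3) ((univ : Finset (Fin n)) \ {i, j}) *
          (hcProb (Ov ε) (volume : Measure T3) (univ : Finset (Fin n)))⁻¹) * volume T := by
  classical
  have hE := measurableSet_pairEvent (n := n) i j hT
  rw [posGibbsMeasure_eq continuous_const (fun _ => one_pos) ε n, Measure.smul_apply, smul_eq_mul,
    Measure.restrict_apply hE, profileOf_one_μ, Xi, firstLabels_self, profileOf_one_μ, Set.inter_comm]
  calc ENNReal.ofReal (hcProb (Ov ε) (volume : Measure T3) (univ : Finset (Fin n)))⁻¹ *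
        (Measure.pi fun _ : Fin n => (volume : Measure T3))
          (hardCoreSet (Ov ε) (univ : Finset (Fin n)) ∩ {x | x i - x j ∈ T})
      ≤ ENNReal.ofReal (hcProb (Ov ε) (volume : Measure T3) (univ : Finset (Fin n)))⁻¹ *
          (ENNReal.ofReal (hcProb (Ov ε) (volume : Measure T3) ((univ : Finset (Fin n)) \ {i, j})) * volume T) :=
        mul_le_mul' le_rfl (pi_hardCore_inter_pairEvent_le ε hij hT)
    _ = ENNReal.ofReal (hcProb (Ov ε) (volume : Measure T3) ((univ : Finset (Fin n)) \ {i, j}) *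
          (hcProb (Ov ε) (volume : Measure T3) (univ : Finset (Fin n)))⁻¹) * volume T := by
        rw [ENNReal.ofReal_mul (hcProb_nonneg _ _), ← mul_assoc, mul_comm (ENNReal.ofReal _⁻¹)]

/-- The ratio of hard-core probabilities along the hydrodynamic scaling is a product of two insertion ratios:
`Ξ_N(univ ∖ {i,j}) / Ξ_N(univ) = q_N(N−1) · q_N(N)` (`N ≥ 1`, `i ≠ j` among `N + 1` labels). [folklore] -/
theorem hcProb_sdiff_pair_div_eq (σ : ℝ) {N : ℕ} (hN : 1 ≤ N) {i j : Fin (N + 1)} (hij : i ≠ j)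
    (hpos : ∀ m ≤ N + 1, 0 < XiN uniformProfile σ N m) :
    hcProb (Ov (hsDiameter σ N)) (volume : Measure T3) ((univ : Finset (Fin (N + 1))) \ {i, j}) *
        (hcProb (Ov (hsDiameter σ N)) (volume : Measure T3) (univ : Finset (Fin (N + 1))))⁻¹
      = qN uniformProfile σ N (N - 1) * qN uniformProfile σ N N := by
  classical
  have hcard : ((univ : Finset (Fin (N + 1))) \ {i, j}).card = (firstLabels (N + 1) (N - 1)).card := by
    rw [card_sdiff, Finset.inter_univ, card_univ, Fintype.card_fin, card_pair hij, card_firstLabels (by omega)]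
    omega
  have h1 : hcProb (Ov (hsDiameter σ N)) (volume : Measure T3) ((univ : Finset (Fin (N + 1))) \ {i, j})
      = XiN uniformProfile σ N (N - 1) := by
    rw [XiN, Xi, uniformProfile_μ]
    exact hcProb_eq_of_card_eq (volume : Measure T3) (measurableSet_ov _) hcard
  have h2 : hcProb (Ov (hsDiameter σ N)) (volume : Measure T3) (univ : Finset (Fin (N + 1)))
      = XiN uniformProfile σ N (N + 1) := by
    rw [XiN, Xi, uniformProfile_μ, firstLabels_self]
  rw [h1, h2, qN, qN, show N - 1 + 1 = N by omega]
  have hN0 := (hpos N (by omega)).ne'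
  have hN1 := (hpos (N + 1) le_rfl).ne'
  field_simp

/-- **Ruelle-type bound for the canonical pair law at small density.** Under `SmallDensity uniformProfile σ`, for every
`N ≥ 1`, `i ≠ j` and measurable `T ⊆ 𝕋³`:
`posGibbsMeasure 1 (hsDiameter σ N) (N+1) {x_i − x_j ∈ T} ≤ 4 · vol(T)` — uniformly in `N` and in `T`, in particular for
sets of Haar measure `O(ε_N³)` at the contact scale. [folklore] -/
theorem posGibbs_pairEvent_le {σ : ℝ} (h : SmallDensity uniformProfile σ) {N : ℕ} (hN : 1 ≤ N)
    {i j : Fin (N + 1)} (hij : i ≠ j) {T : Set T3} (hT : MeasurableSet T) :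
    posGibbsMeasure (fun _ => (1 : ℝ)) (hsDiameter σ N) (N + 1) {x | x i - x j ∈ T} ≤ 4 * volume T := by
  have hpos : ∀ m ≤ N + 1, 0 < XiN uniformProfile σ N m := fun m hm =>
    XiN_pos h.σ_pos.le h.σ_lt_half h.ovDensity_lt_one hm
  refine (posGibbs_pairEvent_le_ratio (hsDiameter σ N) hij hT).trans ?_
  rw [hcProb_sdiff_pair_div_eq σ hN hij hpos]
  refine mul_le_mul' ?_ le_rfl
  have hq1 : qN uniformProfile σ N (N - 1) ≤ 2 := h.qN_le_two (by omega)
  have hq2 : qN uniformProfile σ N N ≤ 2 := h.qN_le_two le_rfl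
  have hq1' : 0 ≤ qN uniformProfile σ N (N - 1) :=
    (qN_pos h.σ_pos.le h.σ_lt_half h.ovDensity_lt_one (by omega)).le
  calc ENNReal.ofReal (qN uniformProfile σ N (N - 1) * qN uniformProfile σ N N)
      ≤ ENNReal.ofReal (2 * 2) := ENNReal.ofReal_le_ofReal (mul_le_mul hq1 hq2
          (qN_pos h.σ_pos.le h.σ_lt_half h.ovDensity_lt_one le_rfl).le (by norm_num))
    _ = 4 := by rw [show (2 : ℝ) * 2 = 4 by norm_num]; norm_num

/-- **The same bound in the crux's parametrisation** (`σ < σ₀` for the `σ₀` of `exists_smallDensity uniformProfile`):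
there is `σ₀ > 0` such that for `0 < σ < σ₀`, all `N ≥ 1`, `i ≠ j`, measurable `T`,
`posGibbsMeasure 1 (hsDiameter σ N) (N+1) {x_i − x_j ∈ T} ≤ 4 · vol(T)`. [folklore] -/
theorem exists_posGibbs_pairEvent_le :
    ∃ σ₀ : ℝ, 0 < σ₀ ∧ ∀ σ : ℝ, 0 < σ → σ < σ₀ → ∀ N : ℕ, 1 ≤ N → ∀ i j : Fin (N + 1), i ≠ j →
      ∀ T : Set T3, MeasurableSet T →
        posGibbsMeasure (fun _ => (1 : ℝ)) (hsDiameter σ N) (N + 1) {x | x i - x j ∈ T} ≤ 4 * volume T := by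
  obtain ⟨σ₀, hσ₀, hsmall⟩ := exists_smallDensity uniformProfile one_pos
  exact ⟨σ₀, hσ₀, fun σ hσ hσlt N hN i j hij T hT => posGibbs_pairEvent_le (hsmall σ hσ hσlt).1 hN hij hT⟩

end Literature.MathematicalPhysics.KineticTheory

end
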